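import Mathlib

/-!
# T5KatzTheta — Katz's operator `θ = t·d/dt` and the substitutions `t ↦ t^a` on t-expansions

Kernel annex for `route/T5-CHECK-G-p7.md` §4 [R-2′] and §9.5 (Tier 5, support for N5 / §G):
the [A]-reading of the shape (6.1) of Burungale–Hida, Algebra & Number Theory 11 (2017), for a
branch of infinity type `kΣ + κ₀(1−c)` with `κ₀ ≠ 0` rests on the one-line identity
`a ∘ (θ^κ f) = a^{−κ} · θ^κ (a ∘ f)` between Katz's operator `θ = t·d/dt` and the automorphism
`a : t ↦ t^a` of the one-dimensional 𝔭-line Serre–Tate deformation space (`[F_𝔭 : ℚ_p] = 1`).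
This file checks that identity for NATURAL exponents `a ≠ 0` in both coordinates:

* `X = t` (expansions at `t = 0`, the `q`-expansion convention): `a` acts by `PowerSeries.expand`,
  i.e. `X ↦ X ^ a`, and `θ f = X * f'` (`theta`, `actPow`);
* `X = t − 1` (Serre–Tate expansions at the origin `t = 1`): `a` acts by `X ↦ (1 + X) ^ a − 1`
  and `θ f = (1 + X) * f'` (`thetaST`, `actST`).

In both cases `θ^[k] (a ∘ f) = a ^ k * (a ∘ θ^[k] f)`. Nothing about measures, Eisenstein series
or the interpolation formula is asserted; the prose's `a ∈ ℤ_p^×` is reached from the natural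
exponents by `p`-adic continuity, which is NOT formalised here. Mathlib only; axioms standard. -/

namespace Summit.Ventures.HodgeRepro2.T5KatzTheta

open PowerSeries

variable {R : Type*} [CommRing R]

/-! ### Coordinate `X = t` -/

/-- Katz's operator `θ = t·d/dt` in the coordinate `X = t`. -/
noncomputable def theta (f : R⟦X⟧) : R⟦X⟧ := X * derivative R f

/-- The substitution `X ↦ X ^ a` (the automorphism `t ↦ t^a` in the coordinate `X = t`). -/
noncomputable def actPow (a : ℕ) (f : R⟦X⟧) : R⟦X⟧ := f.subst (X ^ a : R⟦X⟧)

/-- `θ` commutes with multiplication by the constants `(n : R⟦X⟧)` (a derivation kills them). -/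
theorem theta_natCast_mul (n : ℕ) (g : R⟦X⟧) :
    theta ((n : R⟦X⟧) * g) = (n : R⟦X⟧) * theta g := by
  unfold theta
  rw [Derivation.leibniz, Derivation.map_natCast, smul_zero, add_zero, smul_eq_mul]
  ring

/-- Iterated form of `theta_natCast_mul`. -/
theorem theta_iterate_natCast_mul (n : ℕ) (g : R⟦X⟧) (k : ℕ) :
    theta^[k] ((n : R⟦X⟧) * g) = (n : R⟦X⟧) * theta^[k] g := by
  induction k generalizing g with
  | zero => rfl
  | succ k ih => rw [Function.iterate_succ_apply, theta_natCast_mul, ih, Function.iterate_succ_apply]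

/-- `θ (f(X^a)) = a · (θ f)(X^a)`: the chain rule for `X ↦ X ^ a`. -/
theorem theta_actPow {a : ℕ} (ha : a ≠ 0) (f : R⟦X⟧) :
    theta (actPow a f) = (a : R⟦X⟧) * actPow a (theta f) := by
  unfold theta actPow
  rw [derivative_subst R (HasSubst.X_pow ha), derivative_pow, derivative_X, mul_one,
    subst_mul (HasSubst.X_pow ha), subst_X (HasSubst.X_pow ha)]
  obtain ⟨b, rfl⟩ : ∃ b, a = b + 1 := ⟨a - 1, by omega⟩
  simp only [Nat.add_sub_cancel]
  ring

/-- The same identity written with `PowerSeries.expand`. -/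
theorem theta_expand {a : ℕ} (ha : a ≠ 0) (f : R⟦X⟧) :
    theta (expand a ha f) = (a : R⟦X⟧) * expand a ha (theta f) := by
  rw [expand_apply, expand_apply]
  exact theta_actPow ha f

/-- `actPow a` is multiplicative (it is the algebra homomorphism `substAlgHom`). -/
theorem actPow_mul {a : ℕ} (ha : a ≠ 0) (f g : R⟦X⟧) :
    actPow a (f * g) = actPow a f * actPow a g :=
  subst_mul (HasSubst.X_pow ha) f g

/-- `actPow a` fixes the constants `(n : R⟦X⟧)`. -/
theorem actPow_natCast {a : ℕ} (ha : a ≠ 0) (n : ℕ) :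
    actPow a (n : R⟦X⟧) = (n : R⟦X⟧) := by
  unfold actPow
  rw [← coe_substAlgHom (HasSubst.X_pow ha), map_natCast]

/-- Iterated form: `θ^[k] (f(X^a)) = a^k · (θ^[k] f)(X^a)` — the identity
`a ∘ (θ^κ f) = a^{−κ} θ^κ (a ∘ f)` of CHECK-G §4 [R-2′], in multiplicative form. -/
theorem theta_iterate_actPow {a : ℕ} (ha : a ≠ 0) (f : R⟦X⟧) (k : ℕ) :
    theta^[k] (actPow a f) = (a : R⟦X⟧) ^ k * actPow a (theta^[k] f) := by
  induction k generalizing f with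
  | zero => simp
  | succ k ih =>
    rw [Function.iterate_succ_apply, theta_actPow ha, theta_iterate_natCast_mul, ih,
      Function.iterate_succ_apply, pow_succ]
    ring

/-! ### Coordinate `X = t − 1` (Serre–Tate expansions at the origin `t = 1`) -/

/-- The series `(1 + X) ^ a − 1`, i.e. `t^a − 1` in the coordinate `X = t − 1`. -/
noncomputable def stSubst (a : ℕ) : R⟦X⟧ := (1 + X) ^ a - 1

/-- `X ↦ (1 + X) ^ a − 1` is an admissible substitution (constant coefficient `0`). -/
theorem hasSubst_stSubst (a : ℕ) : HasSubst (stSubst a : R⟦X⟧) :=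
  HasSubst.of_constantCoeff_zero' (by simp [stSubst])

/-- The automorphism `t ↦ t^a` in the coordinate `X = t − 1`. -/
noncomputable def actST (a : ℕ) (f : R⟦X⟧) : R⟦X⟧ := f.subst (stSubst a : R⟦X⟧)

/-- Katz's operator `θ = t·d/dt = (1 + X)·d/dX` in the coordinate `X = t − 1`. -/
noncomputable def thetaST (f : R⟦X⟧) : R⟦X⟧ := (1 + X) * derivative R f

/-- `d/dX ((1 + X)^a − 1) = a (1 + X)^(a − 1)`. -/
theorem derivative_stSubst (a : ℕ) :
    derivative R (stSubst a : R⟦X⟧) = (a : R⟦X⟧) * (1 + X) ^ (a - 1) := by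
  unfold stSubst
  rw [map_sub, derivative_pow, map_add, derivative_X, Derivation.map_one_eq_zero]
  ring

/-- `(1 + X)` is sent to `(1 + X) ^ a` by the substitution. -/
theorem actST_one_add_X (a : ℕ) :
    actST a (1 + X : R⟦X⟧) = (1 + X) ^ a := by
  unfold actST
  rw [← coe_substAlgHom (hasSubst_stSubst a), map_add, map_one, coe_substAlgHom,
    subst_X (hasSubst_stSubst a), stSubst, add_sub_cancel]

/-- `thetaST` commutes with multiplication by the constants `(n : R⟦X⟧)`. -/
theorem thetaST_natCast_mul (n : ℕ) (g : R⟦X⟧) :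
    thetaST ((n : R⟦X⟧) * g) = (n : R⟦X⟧) * thetaST g := by
  unfold thetaST
  rw [Derivation.leibniz, Derivation.map_natCast, smul_zero, add_zero, smul_eq_mul]
  ring

/-- Iterated form of `thetaST_natCast_mul`. -/
theorem thetaST_iterate_natCast_mul (n : ℕ) (g : R⟦X⟧) (k : ℕ) :
    thetaST^[k] ((n : R⟦X⟧) * g) = (n : R⟦X⟧) * thetaST^[k] g := by
  induction k generalizing g with
  | zero => rfl
  | succ k ih =>
    rw [Function.iterate_succ_apply, thetaST_natCast_mul, ih, Function.iterate_succ_apply]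

/-- `θ (f ∘ a) = a · ((θ f) ∘ a)` in the Serre–Tate coordinate: the chain rule for
`X ↦ (1 + X)^a − 1`, using `(1 + X) · (1 + X)^(a−1) = (1 + X)^a = 1 + ((1 + X)^a − 1)`. -/
theorem thetaST_actST {a : ℕ} (ha : a ≠ 0) (f : R⟦X⟧) :
    thetaST (actST a f) = (a : R⟦X⟧) * actST a (thetaST f) := by
  have h1 : actST a (thetaST f) = (1 + X) ^ a * actST a (derivative R f) := by
    unfold thetaST
    rw [show actST a ((1 + X) * derivative R f)
        = actST a (1 + X) * actST a (derivative R f) from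
        subst_mul (hasSubst_stSubst a) _ _, actST_one_add_X]
  rw [h1]
  unfold thetaST actST
  rw [derivative_subst R (hasSubst_stSubst a), derivative_stSubst]
  obtain ⟨b, rfl⟩ : ∃ b, a = b + 1 := ⟨a - 1, by omega⟩
  simp only [Nat.add_sub_cancel]
  ring

/-- Iterated form in the Serre–Tate coordinate: `θ^[k] (f ∘ a) = a^k · ((θ^[k] f) ∘ a)`. -/
theorem thetaST_iterate_actST {a : ℕ} (ha : a ≠ 0) (f : R⟦X⟧) (k : ℕ) :
    thetaST^[k] (actST a f) = (a : R⟦X⟧) ^ k * actST a (thetaST^[k] f) := by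
  induction k generalizing f with
  | zero => simp
  | succ k ih =>
    rw [Function.iterate_succ_apply, thetaST_actST ha, thetaST_iterate_natCast_mul, ih,
      Function.iterate_succ_apply, pow_succ]
    ring

/-! ### The eigenvectors `t^y = (1 + X)^y` of `θ` (the moment mechanism of Hsieh's Prop. 5.2, Q13)

In the Serre–Tate coordinate the Amice transform of a measure `m` on `O_𝔭 = ℤ_p` is
`f_m(t) = ∫ t^y dm(y)`, and Katz's operator brings down the variable: `θ (t^y) = y · t^y`, so
`θ^κ f_m |_{t = 1} = ∫ y^κ dm = ∫ ν_κ dm` (Hsieh 2014 Prop. 5.2, last display). Only the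
eigenvector identity for natural `y` — i.e. for Dirac measures at `y ∈ ℕ` and their finite
sums — is checked here; passing to general measures is the prose's continuity step. -/

/-- `θ (t^y) = y · t^y` in the coordinate `X = t − 1`. -/
theorem thetaST_one_add_X_pow (y : ℕ) :
    thetaST ((1 + X : R⟦X⟧) ^ y) = (y : R⟦X⟧) * (1 + X) ^ y := by
  unfold thetaST
  rw [derivative_pow, map_add, derivative_X, Derivation.map_one_eq_zero, zero_add, mul_one]
  rcases Nat.eq_zero_or_pos y with hy | hy
  · subst hy; simp
  · obtain ⟨b, rfl⟩ : ∃ b, y = b + 1 := ⟨y - 1, by omega⟩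
    simp only [Nat.add_sub_cancel]
    ring

/-- `θ^[k] (t^y) = y^k · t^y`: the `k`-th moment of the Dirac measure at `y`. -/
theorem thetaST_iterate_one_add_X_pow (y k : ℕ) :
    thetaST^[k] ((1 + X : R⟦X⟧) ^ y) = (y : R⟦X⟧) ^ k * (1 + X) ^ y := by
  induction k with
  | zero => simp
  | succ k ih =>
    rw [Function.iterate_succ_apply', ih, ← Nat.cast_pow, thetaST_natCast_mul, Nat.cast_pow,
      thetaST_one_add_X_pow, pow_succ]
    ring

/-- The constant term of `θ^[k] (t^y)` is `y^k` (the moment, read off at the origin `t = 1`). -/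
theorem constantCoeff_thetaST_iterate_one_add_X_pow (y k : ℕ) :
    constantCoeff (thetaST^[k] ((1 + X : R⟦X⟧) ^ y)) = (y : R) ^ k := by
  rw [thetaST_iterate_one_add_X_pow]
  simp

/-- In the coordinate `X = t`, `θ (X^y) = y · X^y`. -/
theorem theta_X_pow (y : ℕ) : theta ((X : R⟦X⟧) ^ y) = (y : R⟦X⟧) * X ^ y := by
  unfold theta
  rw [derivative_pow, derivative_X, mul_one]
  rcases Nat.eq_zero_or_pos y with hy | hy
  · subst hy; simp
  · obtain ⟨b, rfl⟩ : ∃ b, y = b + 1 := ⟨y - 1, by omega⟩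
    simp only [Nat.add_sub_cancel]
    ring

/-- `θ^[k] (X^y) = y^k · X^y`. -/
theorem theta_iterate_X_pow (y k : ℕ) :
    theta^[k] ((X : R⟦X⟧) ^ y) = (y : R⟦X⟧) ^ k * X ^ y := by
  induction k with
  | zero => simp
  | succ k ih =>
    rw [Function.iterate_succ_apply', ih, ← Nat.cast_pow, theta_natCast_mul, Nat.cast_pow,
      theta_X_pow, pow_succ]
    ring

end Summit.Ventures.HodgeRepro2.T5KatzTheta
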